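import Mathlib
import HarnessLib
import Summits.NavierStokesRegularity.NavierStokesRegularity.Theses.RellichScar

/-!
# Sketch — first lemmas for the crux ideas on `RellichScar.ScarRigidity` (crux-ideate round 1, ideator 2)

Nothing here is proved; these are the *first checkable statements* of two lines, stated over
existing declarations so that they elaborate.  `InApexClass` / `SameScar` merely abbreviate the
standing hypotheses of the crux (verbatim sub-formulas of `RellichScar.ScarRigidity`).
-/

namespace Summit.NavierStokesRegularity.NavierStokesRegularity.Cruxes.ScarRigidity.Sketch

open MeasureTheory Filter Set Function
open Literature.Analysis.FluidPDE

local notation "ℝ³" => EuclideanSpace ℝ (Fin 3)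

/-- The apex class at level `C` (the four standing hypotheses of every item of the route). -/
def InApexClass (C : ℝ) (u : ℝ → ℝ³ → ℝ³) (p : ℝ → ℝ³ → ℝ) (G : ℝ → ℝ³ → ℝ³ →L[ℝ] ℝ³) : Prop :=
  IsSuitableWeakSolutionOn (slab ℝ³ (Iio 0) isOpen_Iio) 1 0 u p ∧
  HasWeakSpatialGradientOn (slab ℝ³ (Iio 0) isOpen_Iio) u G ∧
  typeIBound (Iio (0 : ℝ) ×ˢ univ) u p G < ⊤ ∧ HasTypeIDecay C u

/-- Same scar (verbatim the hypothesis of `ScarRigidity`). -/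
def SameScar (u₁ u₂ : ℝ → ℝ³ → ℝ³) : Prop :=
  ∀ K : Set ℝ³, IsCompact K → (0 : ℝ³) ∉ K →
    Tendsto (fun δ : ℝ => eLpNorm (uncurry u₁ - uncurry u₂) ⊤
      (volume.restrict (Ioo (-δ) 0 ×ˢ K))) (nhdsWithin 0 (Ioi 0)) (nhds 0)

/-- Cross product on `ℝ³ = EuclideanSpace ℝ (Fin 3)` (components). -/
def cross (a b : ℝ³) : ℝ³ :=
  WithLp.toLp 2 ![a 1 * b 2 - a 2 * b 1, a 2 * b 0 - a 0 * b 2, a 0 * b 1 - a 1 * b 0]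

/-! ## Card `moment-conditioned-rellich` -/

/-- **Support lemma A0 (provable now): the scar fixes total momentum and angular momentum.**
For two apex profiles with the same scar the momentum defect `∫ (u₁ − u₂)(t) dx` vanishes for
every `t < 0` (it is conserved, and it tends to `0` as `t ↑ 0` because
`|u₁ − u₂| ≲ (−t)^{3/2}|x|⁻⁴` off the parabola and `≲ C/(|x|+√−t)` inside), and so does the
angular-momentum defect, taken as a limit over balls (the torque of the pair vanishes exactly:
`u₁⊗u₁ − u₂⊗u₂` is symmetric and the pressure torque is a vanishing boundary term). -/
def ConservedDefectsVanish : Prop :=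
  ∀ (u₁ : ℝ → ℝ³ → ℝ³) (p₁ : ℝ → ℝ³ → ℝ) (G₁ : ℝ → ℝ³ → ℝ³ →L[ℝ] ℝ³)
    (u₂ : ℝ → ℝ³ → ℝ³) (p₂ : ℝ → ℝ³ → ℝ) (G₂ : ℝ → ℝ³ → ℝ³ →L[ℝ] ℝ³) (C : ℝ),
    InApexClass C u₁ p₁ G₁ → InApexClass C u₂ p₂ G₂ →
    IsBackwardSingularPoint u₁ 0 → IsBackwardSingularPoint u₂ 0 → SameScar u₁ u₂ →
    ∀ t < 0,
      Integrable (fun x => u₁ t x - u₂ t x) volume ∧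
      ∫ x, (u₁ t x - u₂ t x) = 0 ∧
      Tendsto (fun R : ℝ => ∫ x in Metric.ball (0 : ℝ³) R, cross x (u₁ t x - u₂ t x))
        atTop (nhds 0)

/-- **First lemma A1 (Step B of the line, "Landis/Jerison–Kenig at infinity for the
Stokes–Ornstein–Uhlenbeck system"): a super-polynomially non-radiating pair coincides.**
If two singular apex profiles differ by `O((−t)^{(N−1)/2}|x|^{−N})` for EVERY `N` (in Leray
variables: `|U₁ − U₂| = O(|y|^{−N})` uniformly in `s`, i.e. all radiative multipole moments
vanish), then they coincide.  The crux is A1 + the moment hierarchy (all `Q_ℓ(s)`, `ℓ ≥ 2`,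
vanish), the hypothesis here being exactly "all orders of the pressure-painted tail are zero". -/
def FlatScarRigidity : Prop :=
  ∀ (u₁ : ℝ → ℝ³ → ℝ³) (p₁ : ℝ → ℝ³ → ℝ) (G₁ : ℝ → ℝ³ → ℝ³ →L[ℝ] ℝ³)
    (u₂ : ℝ → ℝ³ → ℝ³) (p₂ : ℝ → ℝ³ → ℝ) (G₂ : ℝ → ℝ³ → ℝ³ →L[ℝ] ℝ³) (C : ℝ),
    InApexClass C u₁ p₁ G₁ → InApexClass C u₂ p₂ G₂ →
    IsBackwardSingularPoint u₁ 0 → IsBackwardSingularPoint u₂ 0 →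
    (∀ N : ℕ, ∃ K : ℝ, ∀ t < 0, ∀ x : ℝ³, x ≠ 0 →
      ‖u₁ t x - u₂ t x‖ ≤ K * (Real.sqrt (-t))⁻¹ * (Real.sqrt (-t) / ‖x‖) ^ N) →
    uncurry u₁ =ᵐ[volume.restrict (Iio (0 : ℝ) ×ˢ univ)] uncurry u₂

/-- **Lemma A2 (first rung of the hierarchy, the quadrupole): vanishing Reynolds-stress defect
upgrades the decay by one order.**  `Q(t) = ∫ (u₁⊗u₁ − u₂⊗u₂)(t) dx` converges absolutely for a
scar-sharing pair; if its trace-free part vanishes for all `t < 0` then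
`|u₁ − u₂| ≲ (−t)²|x|⁻⁵` (the `ℓ = 2` painted term is gone). -/
def QuadrupoleRung : Prop :=
  ∀ (u₁ : ℝ → ℝ³ → ℝ³) (p₁ : ℝ → ℝ³ → ℝ) (G₁ : ℝ → ℝ³ → ℝ³ →L[ℝ] ℝ³)
    (u₂ : ℝ → ℝ³ → ℝ³) (p₂ : ℝ → ℝ³ → ℝ) (G₂ : ℝ → ℝ³ → ℝ³ →L[ℝ] ℝ³) (C : ℝ),
    InApexClass C u₁ p₁ G₁ → InApexClass C u₂ p₂ G₂ →
    IsBackwardSingularPoint u₁ 0 → IsBackwardSingularPoint u₂ 0 → SameScar u₁ u₂ →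
    (∀ t < 0, ∀ i j : Fin 3,
      ∫ x, ((u₁ t x) i * (u₁ t x) j - (u₂ t x) i * (u₂ t x) j
        - (if i = j then (‖u₁ t x‖ ^ 2 - ‖u₂ t x‖ ^ 2) / 3 else 0)) = 0) →
    ∃ K : ℝ, ∀ t < 0, ∀ x : ℝ³, x ≠ 0 →
      ‖u₁ t x - u₂ t x‖ ≤ K * (Real.sqrt (-t))⁻¹ * (Real.sqrt (-t) / ‖x‖) ^ 5

/-! ## Card `zoom-cocycle-symmetry-locking` -/

/-- **First lemma B1 (symmetry locking of scar fibres).**  Two singular apex profiles with the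
same scar lie on the same orbit of the similarity group `ℝ₊ × O(3)`: `u₂` is a rescaled,
rotated copy of `u₁`.  (The lever — zero Lyapunov directions of the quasi-compact zoom cocycle
are symmetry directions — proves exactly this; the crux is B1 + B2.) -/
def SymmetryLocking : Prop :=
  ∀ (u₁ : ℝ → ℝ³ → ℝ³) (p₁ : ℝ → ℝ³ → ℝ) (G₁ : ℝ → ℝ³ → ℝ³ →L[ℝ] ℝ³)
    (u₂ : ℝ → ℝ³ → ℝ³) (p₂ : ℝ → ℝ³ → ℝ) (G₂ : ℝ → ℝ³ → ℝ³ →L[ℝ] ℝ³) (C : ℝ),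
    InApexClass C u₁ p₁ G₁ → InApexClass C u₂ p₂ G₂ →
    IsBackwardSingularPoint u₁ 0 → IsBackwardSingularPoint u₂ 0 → SameScar u₁ u₂ →
    ∃ (lam : ℝ) (R : ℝ³ ≃ₗᵢ[ℝ] ℝ³), 0 < lam ∧
      uncurry u₂ =ᵐ[volume.restrict (Iio (0 : ℝ) ×ˢ univ)]
        uncurry (fun t x => R (nsRescale lam u₁ t (R.symm x)))

/-- **Lemma B1-loc (local symmetry locking, the form the hyperbolicity bet proves first and the
form `closes` actually consumes):** at each level `C` there are a compact space–time set `K` in the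
open past and an `ε > 0` such that two singular apex profiles with the same scar that are
`ε`-close in `L^∞(K)` lie on one orbit of the similarity group. -/
def LocalSymmetryLocking : Prop :=
  ∀ C : ℝ, ∃ (K : Set (ℝ × ℝ³)) (ε : ℝ), IsCompact K ∧ K ⊆ Iio (0 : ℝ) ×ˢ univ ∧ 0 < ε ∧
    ∀ (u₁ : ℝ → ℝ³ → ℝ³) (p₁ : ℝ → ℝ³ → ℝ) (G₁ : ℝ → ℝ³ → ℝ³ →L[ℝ] ℝ³)
      (u₂ : ℝ → ℝ³ → ℝ³) (p₂ : ℝ → ℝ³ → ℝ) (G₂ : ℝ → ℝ³ → ℝ³ →L[ℝ] ℝ³),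
      InApexClass C u₁ p₁ G₁ → InApexClass C u₂ p₂ G₂ →
      IsBackwardSingularPoint u₁ 0 → IsBackwardSingularPoint u₂ 0 → SameScar u₁ u₂ →
      eLpNorm (uncurry u₁ - uncurry u₂) ⊤ (volume.restrict K) < ENNReal.ofReal ε →
      ∃ (lam : ℝ) (R : ℝ³ ≃ₗᵢ[ℝ] ℝ³), 0 < lam ∧
        uncurry u₂ =ᵐ[volume.restrict (Iio (0 : ℝ) ×ˢ univ)]
          uncurry (fun t x => R (nsRescale lam u₁ t (R.symm x)))

/-- **Lemma B2 (profiles are as symmetric as their scars, along the similarity group).**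
A singular apex profile whose scar is invariant under a similarity `g = (λ, R)` is itself
`g`-invariant.  For `g` in a one-parameter subgroup this is the infinitesimal Liouville theorem
"a symmetry generator with zero scar vanishes"; the assembly of the route needs only that case. -/
def SymmetricScarRigidity : Prop :=
  ∀ (u : ℝ → ℝ³ → ℝ³) (p : ℝ → ℝ³ → ℝ) (G : ℝ → ℝ³ → ℝ³ →L[ℝ] ℝ³) (C : ℝ)
    (lam : ℝ) (R : ℝ³ ≃ₗᵢ[ℝ] ℝ³), 0 < lam →
    InApexClass C u p G → IsBackwardSingularPoint u 0 →
    SameScar u (fun t x => R (nsRescale lam u t (R.symm x))) →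
    uncurry u =ᵐ[volume.restrict (Iio (0 : ℝ) ×ˢ univ)]
      uncurry (fun t x => R (nsRescale lam u t (R.symm x)))

/-- **B2′ (the one-parameter form, which is ALL that the route's deciding theorem `closes` consumes):**
scar invariant under every rescaling ⇒ a.e. self-similar; scar invariant under every rotation about
`e₃` ⇒ a.e. axisymmetric.  Implied by `ScarRigidity` + `SimilarityCovariance`; strictly weaker than
the filed crux (no accidental discrete symmetries, no unrelated pairs). Planner advice, not a restatement. -/
def OneParameterScarRigidity : Prop :=
  ∀ (u : ℝ → ℝ³ → ℝ³) (p : ℝ → ℝ³ → ℝ) (G : ℝ → ℝ³ → ℝ³ →L[ℝ] ℝ³) (C : ℝ),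
    InApexClass C u p G → IsBackwardSingularPoint u 0 →
    ((∀ lam : ℝ, 0 < lam → SameScar (nsRescale lam u) u) →
      ∀ lam : ℝ, 0 < lam →
        uncurry (nsRescale lam u) =ᵐ[volume.restrict (Iio (0 : ℝ) ×ˢ univ)] uncurry u) ∧
    ((∀ θ : ℝ, SameScar (fun t x => rotZ θ (u t (rotZ (-θ) x))) u) →
      ∀ θ : ℝ, uncurry (fun t x => rotZ θ (u t (rotZ (-θ) x)))
        =ᵐ[volume.restrict (Iio (0 : ℝ) ×ˢ univ)] uncurry u)

/-- The split of the crux (logic + a.e.-congruence of the scar relation): B1 ∧ B2 ⇒ ScarRigidity. -/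
def LockingSplit : Prop :=
  SymmetryLocking → SymmetricScarRigidity →
    Summit.NavierStokesRegularity.NavierStokesRegularity.Theses.RellichScar.ScarRigidity

/-- `LockingSplit` holds: pure logic plus a.e.-congruence of the scar relation. -/
theorem lockingSplit_holds : LockingSplit := by
  intro hLock hSym
  intro u₁ p₁ G₁ u₂ p₂ G₂ C hs₁ hg₁ hI₁ hd₁ hs₂ hg₂ hI₂ hd₂ hsing₁ hsing₂ hscar
  have hA₁ : InApexClass C u₁ p₁ G₁ := ⟨hs₁, hg₁, hI₁, hd₁⟩
  have hA₂ : InApexClass C u₂ p₂ G₂ := ⟨hs₂, hg₂, hI₂, hd₂⟩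
  have hsc : SameScar u₁ u₂ := fun K hK h0 => hscar K hK h0
  obtain ⟨lam, R, hlam, hae⟩ := hLock u₁ p₁ G₁ u₂ p₂ G₂ C hA₁ hA₂ hsing₁ hsing₂ hsc
  -- the scar of `g • u₁` equals the scar of `u₂` (a.e.-equal fields on the slab)
  have hsc' : SameScar u₁ (fun t x => R (nsRescale lam u₁ t (R.symm x))) := by
    intro K hK h0
    have hsub : Ioo (-(0:ℝ)) 0 ×ˢ K ⊆ Iio (0 : ℝ) ×ˢ (univ : Set ℝ³) := by
      intro z hz; exact ⟨hz.1.2, trivial⟩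
    refine (hsc K hK h0).congr' ?_
    filter_upwards [self_mem_nhdsWithin] with δ hδ
    have hsubδ : Ioo (-δ) 0 ×ˢ K ⊆ Iio (0 : ℝ) ×ˢ (univ : Set ℝ³) := by
      intro z hz; exact ⟨hz.1.2, trivial⟩
    have hae' : uncurry u₂ =ᵐ[volume.restrict (Ioo (-δ) 0 ×ˢ K)]
        uncurry (fun t x => R (nsRescale lam u₁ t (R.symm x))) :=
      ae_restrict_of_ae_restrict_of_subset hsubδ hae
    refine eLpNorm_congr_ae ?_
    filter_upwards [hae'] with z hz
    simp only [Pi.sub_apply, hz]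
  have hfix := hSym u₁ p₁ G₁ C lam R hlam hA₁ hsing₁ hsc'
  exact hfix.trans hae.symm

/-- **Lemma B0 (provable now, pressure-free): finite-window backward uniqueness inside the apex
class.**  If two apex profiles agree a.e. on some time slab `(t₁ − ε, t₁) × ℝ³` with `t₁ < 0`
then they agree on the whole past `(−∞, t₁)`: Leray-projected log-convexity in similarity
variables (the projector commutes with `Δ` and with the dilation generator, `[Δ, y·∇] = 2Δ`).
Injectivity of the zoom cocycle on finite windows is what the multiplicative ergodic theorem
needs on its finite-dimensional part. -/
def FiniteWindowBackwardUniqueness : Prop :=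
  ∀ (u₁ : ℝ → ℝ³ → ℝ³) (p₁ : ℝ → ℝ³ → ℝ) (G₁ : ℝ → ℝ³ → ℝ³ →L[ℝ] ℝ³)
    (u₂ : ℝ → ℝ³ → ℝ³) (p₂ : ℝ → ℝ³ → ℝ) (G₂ : ℝ → ℝ³ → ℝ³ →L[ℝ] ℝ³) (C t₁ ε : ℝ),
    InApexClass C u₁ p₁ G₁ → InApexClass C u₂ p₂ G₂ → t₁ < 0 → 0 < ε →
    uncurry u₁ =ᵐ[volume.restrict (Ioo (t₁ - ε) t₁ ×ˢ univ)] uncurry u₂ →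
    uncurry u₁ =ᵐ[volume.restrict (Iio t₁ ×ˢ univ)] uncurry u₂

section ClosesWithWeakerCrux
open Summit.NavierStokesRegularity.NavierStokesRegularity.Theses.RellichScar

/-- **Certified planner advice:** the route's deciding theorem goes through with the filed crux
`ScarRigidity` (and the support `SimilarityCovariance`) replaced by the strictly weaker
`OneParameterScarRigidity`; all other hypotheses are the route's own items, verbatim.  (Same proof
as the gate-checked `closes`, minus the covariance bookkeeping.) -/
theorem closes_of_oneParameterScarRigidity (hSR : OneParameterScarRigidity) (hZ : SymmetricScarExists)
    (hLoc : ApexLocalisation) (hII : NoTypeII) (hSS : SelfSimilarApexFatal) (hAx : AxisymmetricApexFatal)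
    (hP : TypeIBlowupProfile) (hClay : ClayFromNoBlowup) : _root_.NavierStokesRegularity := by
  apply hClay
  intro ν T hν hT u p hcl hLH hdec
  by_contra hext
  have hI : Literature.Analysis.FluidPDE.IsTypeIBlowup u T := hII ν T hν hT u p ⟨hcl, hext⟩ hLH hdec
  obtain ⟨w, q, H, C, hsw, hgr, hIb, hdecay, hsing⟩ := hP ν T hν hT u p ⟨hcl, hext⟩ hLH hdec hI
  obtain ⟨C', v, q', H', hsw', hgr', hIb', hdec', hsing'⟩ :=
    hLoc C ⟨w, q, H, hsw, hgr, hIb, hdecay, hsing⟩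
  obtain ⟨C'', z, pz, Gz, hsz, hgz, hIz, hdz, hsingz, hsym⟩ :=
    hZ C' ⟨v, q', H', hsw', hgr', hIb', hdec', hsing'⟩
  have hzA : InApexClass C'' z pz Gz := ⟨hsz, hgz, hIz, hdz⟩
  rcases hsym with hhom | hax
  · refine hSS z pz Gz C'' hsz hgz hIz hdz hsingz ?_
    intro lam hlam
    exact (hSR z pz Gz C'' hzA hsingz).1 (fun lam' hlam' K hK h0 => hhom lam' hlam' K hK h0) lam hlam
  · refine hAx z pz Gz C'' hsz hgz hIz hdz hsingz ?_
    intro θ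
    exact (hSR z pz Gz C'' hzA hsingz).2 (fun θ' K hK h0 => hax θ' K hK h0) θ

end ClosesWithWeakerCrux

end Summit.NavierStokesRegularity.NavierStokesRegularity.Cruxes.ScarRigidity.Sketch
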